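import Summits.QuantumFields.BalabanUV.Beta.GAN24.FibreRateTBlockRate

/-!
# `BalabanUV.Beta.GAN24.FineReadoutCauchyScalars` — binder row G-an2-4 / (CONV-C), S-slot located remainder «E3SupRate» (the five DIFF rows of
# typer PART III), located leaf «(N1-Cauchy)» (owner spec `HOME/b2b-balaban-gan24-p1/N1-CAUCHY-SPEC.md`, holder division
# `HOME/b2b-balaban-gan24-formalise-leaf-17/g11/N1-CAUCHY-DIVISION.md`), PART A «matched sub-alias», part 1/3:
# THE LEVEL-DEPENDENT SCALAR INGREDIENTS OF THE NORMALISED MINIMISER AMPLITUDE AT REAL MOMENTUM — BOUNDS AND TWO-LEVEL RATES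

NOT IN PRINT; OUR PROOF ATTEMPT (of the road; THIS file is [folklore] one-variable trigonometry over the tree's currency:
`AliasObjects.gs`, `SymbolTaylor`, `FibreRateTBlockRate` BY NAME; no cited fact, no wall binder, no `def … : Prop`).
HONEST FRAMING (cell contract, verbatim): «discharging `BetaPertH` makes Bałaban's UV stability UNCONDITIONAL — a real constructive-QFT result;
it is NOT the continuum limit and NOT the Clay problem.»  HONEST DEPENDENCY (verbatim): «continuum YM on T⁴ ⇐ BetaPertH ∧ nine spine estimates
(0/9 proved); BetaPertH ⇐ (D1) ∧ (D4) ∧ CAP+tail; G-an2-4 gates asym, D1 and NE2/3/4.»  Discharges NOTHING of (hS, hSall) / «E3SupRate» /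
«(N1-Cauchy)»; NOT `BetaPertH`, NOT continuum, NOT Clay.

## Why (design: journal FINDING of `b2b-balaban-gan24-formalise-leaf-16-g9`, 2026-08-20T05:03Z)
At REAL coarse momentum `q ∈ [−π, π]^D ∖ {0}` the normalised minimiser amplitude of the alias class `m` at blocking `N`,
`N^{D+1}·Ahat N (ofRealVec q) 0 (eVec l) m κ`, is an explicit rational expression in four LEVEL-DEPENDENT scalar families read at the
level-FREE physical label `P = q + 2π·srep m` (`FibreRateTBlock.qlab`):
`a_N(P_κ) = N·(e^{iP_κ/N} − 1)` (`= N·dAl`), `γ_N(P_i) = gs(−P_i/N, N)/N` (`= sbAl/N`, and `χ̂ = Π_i γ_N(P_i)`), `u_N(P) = ℓ_N(P)⁻¹`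
(`ℓ_N = N²·LAl = latticeSymbol N⁻¹ 0 P`, `FibreRateTBlockRate` BY NAME) and the scaled capacitance data (`CapacitanceRateScaled` BY NAME) —
plus the level-free telescoped factor `E_l = e^{−iq_l} − 1` (`= dbAl_l·sbAl_l`).  This file supplies, for `a_N` and `γ_N`, the N-UNIFORM
BOUNDS and the TWO-LEVEL RATES `O((|P|+1)/N)` on King's extended zone `|P_i| ≤ 5πN/3` (parts 2/3 assemble them).

## What is proved (`1 ≤ N ≤ N′`; `x` real; zone `|x| ≤ 5π/3·N` where stated)
* §1 `aS N x := N·(e^{ix/N} − 1)`: `norm_aS_le` (`‖aS N x‖ ≤ |x|`), `norm_aS_ge` (`|x|/6 ≤ ‖aS N x‖` on the zone), `norm_aS_sub_aS_le`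
  (`‖aS N′ x − aS N x‖ ≤ x²/N`).
* §2 `gamS N x := gs(−x/N, N)/N`: `gamS_zero` (`= 1` at `x = 0`; leaf-07's `gs_zero` inlined), `aS_neg_mul_gamS` (`aS N (−x)·gamS N x = e^{−ix} − 1`, the telescoping
  identity), `norm_gamS_le_one`, `norm_gamS_le_div` (`≤ 12/|x|` on the zone, `x ≠ 0`), the weight `wS x := 12/max 12 |x|` with
  `norm_gamS_le_wS`, and the rate `norm_gamS_sub_gamS_le` (`‖gamS N′ x − gamS N x‖ ≤ 72/N` on the zone).
* §3 products over the coordinates: `norm_prod_sub_prod_le` (abstract telescoping `‖Π a′ − Π a‖ ≤ Σ_i δ_i·Π_{j≠i} w_j`), `chiS N P := Π_i gamS N (P i)`,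
  `WS P := Π_i wS (P i)`, `norm_chiS_le_WS`, and the rate `norm_chiS_sub_chiS_le`: `‖chiS N′ P − chiS N P‖ ≤ (6/N)·(Σ_i max 12 |P_i|)·WS P`.
* §4 `ES q l := e^{−iq_l} − 1`, `norm_ES_le` (`≤ |q_l|`).
Unit `b2b-balaban-gan24-formalise-leaf-16` (G-an2-4 formalisation swarm, leaf prover 16, gen 9), 2026-08-20.
-/

noncomputable section

open Complex Finset
open scoped BigOperators Real

namespace Summit.QuantumFields.BalabanUV.Beta.GAN24.FineReadoutCauchyScalars

open Summit.QuantumFields.BalabanUV.Beta.GAN24.AliasObjects (gs)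
open Summit.QuantumFields.BalabanUV.Beta.GAN24.FibreRateTBlockRate (abs_sin_ge_div_six)

/-! ## §1 The scaled first-order symbol `a_N(x) = N·(e^{ix/N} − 1)` -/

/-- [folklore] THE SCALED FIRST-ORDER SYMBOL `a_N(x) := N·(e^{ix/N} − 1)` (`= N·∂̂(x/N)`; `→ ix` as `N → ∞`). -/
def aS (N : ℕ) (x : ℝ) : ℂ := (N : ℂ) * (cexp (I * ((x / N : ℝ) : ℂ)) - 1)

/-- [folklore] `‖a_N(x)‖ ≤ |x|` (`‖e^{iy} − 1‖ ≤ |y|`). -/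
theorem norm_aS_le (N : ℕ) (x : ℝ) : ‖aS N x‖ ≤ |x| := by
  rcases Nat.eq_zero_or_pos N with hN | hN
  · subst hN; simp [aS]
  have hN' : (0 : ℝ) < N := by exact_mod_cast hN
  unfold aS
  rw [norm_mul, Complex.norm_natCast]
  have h := Real.norm_exp_I_mul_ofReal_sub_one_le (x := x / N)
  rw [Real.norm_eq_abs, abs_div, abs_of_pos hN'] at h
  calc (N : ℝ) * ‖cexp (I * ((x / N : ℝ) : ℂ)) - 1‖ ≤ N * (|x| / N) := mul_le_mul_of_nonneg_left h hN'.le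
    _ = |x| := by field_simp

/-- [folklore] `‖a_N(x)‖ = 2N·|sin(x/(2N))|`. -/
theorem norm_aS_eq (N : ℕ) (x : ℝ) : ‖aS N x‖ = 2 * N * |Real.sin (x / (2 * N))| := by
  unfold aS
  rw [norm_mul, Complex.norm_natCast, Complex.norm_exp_I_mul_ofReal_sub_one, Real.norm_eq_abs, abs_mul, abs_two,
    show x / N / 2 = x / (2 * N) by ring]
  ring

/-- [folklore] LOWER BOUND on King's extended zone: `|x| ≤ 5πN/3 ⇒ |x|/6 ≤ ‖a_N(x)‖` (`|sin y| ≥ |y|/6` for `|y| ≤ 5π/6`). -/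
theorem norm_aS_ge {N : ℕ} (hN : 0 < N) {x : ℝ} (hx : |x| ≤ 5 * π / 3 * (N : ℝ)) : |x| / 6 ≤ ‖aS N x‖ := by
  have hN' : (0 : ℝ) < N := by exact_mod_cast hN
  rw [norm_aS_eq N]
  have hy : |x / (2 * N)| ≤ 5 * π / 6 := by
    rw [abs_div, abs_of_pos (by positivity : (0:ℝ) < 2 * N), div_le_iff₀ (by positivity)]
    calc |x| ≤ 5 * π / 3 * N := hx
      _ = 5 * π / 6 * (2 * N) := by ring
  have h := abs_sin_ge_div_six hy
  rw [abs_div, abs_of_pos (by positivity : (0:ℝ) < 2 * N)] at h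
  calc |x| / 6 = 2 * N * (|x| / (2 * N) / 6) := by field_simp
    _ ≤ 2 * N * |Real.sin (x / (2 * N))| := mul_le_mul_of_nonneg_left h (by positivity)

/-- [folklore] **TWO-LEVEL RATE of `a_N`**: `‖a_{N′}(x) − a_N(x)‖ ≤ x²/N` for `1 ≤ N ≤ N′` (both are `ix + O(x²/N)`, `SymbolTaylor` BY NAME). -/
theorem norm_aS_sub_aS_le {N N' : ℕ} (hN : 0 < N) (hNN' : N ≤ N') (x : ℝ) : ‖aS N' x - aS N x‖ ≤ x ^ 2 / N := by
  have hN0 : (0 : ℝ) < N := by exact_mod_cast hN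
  have hN'0 : (0 : ℝ) < N' := by exact_mod_cast lt_of_lt_of_le hN hNN'
  have hNN : (N : ℝ) ≤ N' := by exact_mod_cast hNN'
  have h1 := SymbolTaylor.norm_mul_cexp_sub_one_sub_le hN0 x
  have h2 := SymbolTaylor.norm_mul_cexp_sub_one_sub_le hN'0 x
  have e : aS N' x - aS N x
      = ((N' : ℝ) * (cexp (I * (x / N' : ℝ)) - 1) - I * x) - ((N : ℝ) * (cexp (I * (x / N : ℝ)) - 1) - I * x) := by
    unfold aS; push_cast; ring
  rw [e]
  calc ‖((N' : ℝ) * (cexp (I * (x / N' : ℝ)) - 1) - I * x) - ((N : ℝ) * (cexp (I * (x / N : ℝ)) - 1) - I * x)‖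
      ≤ ‖(N' : ℝ) * (cexp (I * (x / N' : ℝ)) - 1) - I * x‖ + ‖(N : ℝ) * (cexp (I * (x / N : ℝ)) - 1) - I * x‖ := norm_sub_le _ _
    _ ≤ x ^ 2 / (2 * N') + x ^ 2 / (2 * N) := add_le_add h2 h1
    _ ≤ x ^ 2 / (2 * N) + x ^ 2 / (2 * N) := by gcongr
    _ = x ^ 2 / N := by ring

/-! ## §2 The normalised flat box weight `γ_N(x) = gs(−x/N, N)/N` -/

/-- [folklore] THE NORMALISED FLAT BOX WEIGHT `γ_N(x) := gs(−x/N, N)/N = N⁻¹·Σ_{t<N} e^{−ixt/N}` (`= s♭/N`; `χ̂ = Π_i γ_N(P_i)`). -/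
def gamS (N : ℕ) (x : ℝ) : ℂ := gs (-(((x / N : ℝ)) : ℂ)) N / (N : ℂ)

/-- [folklore] `γ_N(0) = 1` (`N ≥ 1`; `gs 0 n = n` is leaf-07's `SourceSidePair.gs_zero`, inlined to keep the import cone small). -/
theorem gamS_zero {N : ℕ} (hN : 0 < N) : gamS N 0 = 1 := by
  have hgs : gs 0 N = N := by unfold AliasObjects.gs; simp
  unfold gamS
  rw [zero_div, Complex.ofReal_zero, neg_zero, hgs]
  exact div_self (Nat.cast_ne_zero.2 hN.ne')

/-- [folklore] **THE TELESCOPING IDENTITY** `a_N(−x)·γ_N(x) = e^{−ix} − 1` (`∂̂♭·s♭ = e^{−ixN/N} − 1`; `AliasWeights.geomExp_mul_sub_one` BY NAME);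
every `N ≥ 1`, every real `x`. -/
theorem aS_neg_mul_gamS {N : ℕ} (hN : 0 < N) (x : ℝ) : aS N (-x) * gamS N x = cexp (-(I * x)) - 1 := by
  have hNc : (N : ℂ) ≠ 0 := Nat.cast_ne_zero.2 hN.ne'
  have hz : (((-x / N : ℝ)) : ℂ) = -(((x / N : ℝ)) : ℂ) := by push_cast; ring
  have hid := AliasWeights.geomExp_mul_sub_one (-(((x / N : ℝ)) : ℂ)) N
  have hexp : cexp (I * -(((x / N : ℝ)) : ℂ) * N) = cexp (-(I * x)) := by
    congr 1; push_cast; field_simp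
  rw [hexp] at hid
  unfold aS gamS AliasObjects.gs
  rw [hz]
  calc (N : ℂ) * (cexp (I * -(((x / N : ℝ)) : ℂ)) - 1) * ((∑ t ∈ Finset.range N, cexp (I * -(((x / N : ℝ)) : ℂ) * t)) / (N : ℂ))
      = (∑ t ∈ Finset.range N, cexp (I * -(((x / N : ℝ)) : ℂ) * t)) * (cexp (I * -(((x / N : ℝ)) : ℂ)) - 1) := by
        field_simp
    _ = cexp (-(I * x)) - 1 := hid

/-- [folklore] `‖γ_N(x)‖ ≤ 1` (a mean of unimodular numbers). -/
theorem norm_gamS_le_one (N : ℕ) (x : ℝ) : ‖gamS N x‖ ≤ 1 := by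
  rcases Nat.eq_zero_or_pos N with hN | hN
  · subst hN; simp [gamS]
  have hN' : (0 : ℝ) < N := by exact_mod_cast hN
  unfold gamS AliasObjects.gs
  rw [norm_div, Complex.norm_natCast, div_le_one hN']
  have h := AliasWeights.norm_geomExp_le (-(x / N)) N
  have e : (((-(x / N) : ℝ)) : ℂ) = -(((x / N : ℝ)) : ℂ) := by push_cast; ring
  rw [e] at h
  exact h

/-- [folklore] `‖γ_N(x)‖ ≤ 12/|x|` for `x ≠ 0` on the zone `|x| ≤ 5πN/3` (telescoping identity ÷ the lower bound `‖a_N(−x)‖ ≥ |x|/6`). -/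
theorem norm_gamS_le_div {N : ℕ} (hN : 0 < N) {x : ℝ} (hx : |x| ≤ 5 * π / 3 * (N : ℝ)) (hx0 : x ≠ 0) : ‖gamS N x‖ ≤ 12 / |x| := by
  have hax : |x| / 6 ≤ ‖aS N (-x)‖ := by
    have := norm_aS_ge hN (x := -x) (by rwa [abs_neg]); rwa [abs_neg] at this
  have hx6 : 0 < |x| / 6 := by positivity
  have ha0 : 0 < ‖aS N (-x)‖ := lt_of_lt_of_le hx6 hax
  have h2 : ‖aS N (-x) * gamS N x‖ ≤ 2 := by
    rw [aS_neg_mul_gamS hN]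
    calc ‖cexp (-(I * x)) - 1‖ ≤ ‖cexp (-(I * (x : ℂ)))‖ + ‖(1 : ℂ)‖ := norm_sub_le _ _
      _ = 2 := by
          rw [show -(I * (x : ℂ)) = I * ((-x : ℝ) : ℂ) by push_cast; ring, Complex.norm_exp_I_mul_ofReal, norm_one]; norm_num
  rw [norm_mul] at h2
  rw [le_div_iff₀ (abs_pos.2 hx0)]
  nlinarith [norm_nonneg (gamS N x)]

/-- THE ONE-COORDINATE WEIGHT `wS x := 12 / max 12 |x|` (`= min(1, 12/|x|)`, division-safe: `wS 0 = 1`). -/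
def wS (x : ℝ) : ℝ := 12 / max 12 |x|

/-- [folklore] `0 < wS x ≤ 1`. -/
theorem wS_pos (x : ℝ) : 0 < wS x := by unfold wS; positivity

/-- [folklore] `wS x ≤ 1`. -/
theorem wS_le_one (x : ℝ) : wS x ≤ 1 := by
  unfold wS; rw [div_le_one (by positivity)]; exact le_max_left _ _

/-- [folklore] `wS x ≤ 12/|x|` (`x ≠ 0`). -/
theorem wS_le_div {x : ℝ} (hx : x ≠ 0) : wS x ≤ 12 / |x| := by
  unfold wS; exact div_le_div_of_nonneg_left (by norm_num) (abs_pos.2 hx) (le_max_right _ _)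

/-- [folklore] `wS x · max 12 |x| = 12`. -/
theorem wS_mul_max (x : ℝ) : wS x * max 12 |x| = 12 := by
  unfold wS; field_simp

/-- [folklore] **`‖γ_N(x)‖ ≤ wS x`** on the zone `|x| ≤ 5πN/3`. -/
theorem norm_gamS_le_wS {N : ℕ} (hN : 0 < N) {x : ℝ} (hx : |x| ≤ 5 * π / 3 * (N : ℝ)) : ‖gamS N x‖ ≤ wS x := by
  unfold wS
  rcases le_or_gt |x| 12 with h | h
  · rw [max_eq_left h, div_self (by norm_num : (12:ℝ) ≠ 0)]; exact norm_gamS_le_one N x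
  · rw [max_eq_right h.le]
    exact norm_gamS_le_div hN hx (by intro h0; rw [h0, abs_zero] at h; linarith)

/-- [folklore] **TWO-LEVEL RATE of `γ_N`**: `‖γ_{N′}(x) − γ_N(x)‖ ≤ 72/N` for `1 ≤ N ≤ N′` on the level-`N` zone `|x| ≤ 5πN/3`
(`γ_N = (e^{−ix} − 1)/a_N(−x)`, `‖a_N(−x)‖ ≥ |x|/6` at both levels, `‖a_{N′}(−x) − a_N(−x)‖ ≤ x²/N`). -/
theorem norm_gamS_sub_gamS_le {N N' : ℕ} (hN : 0 < N) (hNN' : N ≤ N') {x : ℝ} (hx : |x| ≤ 5 * π / 3 * (N : ℝ)) :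
    ‖gamS N' x - gamS N x‖ ≤ 72 / N := by
  have hN0 : (0 : ℝ) < N := by exact_mod_cast hN
  have hN' : 0 < N' := lt_of_lt_of_le hN hNN'
  rcases eq_or_ne x 0 with hx0 | hx0
  · subst hx0; rw [gamS_zero hN, gamS_zero hN', sub_self, norm_zero]; positivity
  have hx' : |x| ≤ 5 * π / 3 * (N' : ℝ) := hx.trans (by gcongr)
  have hax : |x| / 6 ≤ ‖aS N (-x)‖ := by
    have := norm_aS_ge hN (x := -x) (by rwa [abs_neg]); rwa [abs_neg] at this
  have hax' : |x| / 6 ≤ ‖aS N' (-x)‖ := by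
    have := norm_aS_ge hN' (x := -x) (by rwa [abs_neg]); rwa [abs_neg] at this
  have hx6 : 0 < |x| / 6 := by positivity
  have ha0 : aS N (-x) ≠ 0 := norm_pos_iff.1 (lt_of_lt_of_le hx6 hax)
  have ha0' : aS N' (-x) ≠ 0 := norm_pos_iff.1 (lt_of_lt_of_le hx6 hax')
  have hg : gamS N x = (cexp (-(I * x)) - 1) / aS N (-x) := by
    rw [eq_div_iff ha0, mul_comm]; exact aS_neg_mul_gamS hN x
  have hg' : gamS N' x = (cexp (-(I * x)) - 1) / aS N' (-x) := by
    rw [eq_div_iff ha0', mul_comm]; exact aS_neg_mul_gamS hN' x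
  have h2 : ‖cexp (-(I * (x : ℂ))) - 1‖ ≤ 2 := by
    calc ‖cexp (-(I * x)) - 1‖ ≤ ‖cexp (-(I * (x : ℂ)))‖ + ‖(1 : ℂ)‖ := norm_sub_le _ _
      _ = 2 := by
          rw [show -(I * (x : ℂ)) = I * ((-x : ℝ) : ℂ) by push_cast; ring, Complex.norm_exp_I_mul_ofReal, norm_one]; norm_num
  have hrate : ‖aS N (-x) - aS N' (-x)‖ ≤ x ^ 2 / N := by
    rw [norm_sub_rev]; have := norm_aS_sub_aS_le hN hNN' (-x); rwa [neg_sq] at this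
  have e : gamS N' x - gamS N x = (cexp (-(I * x)) - 1) * ((aS N (-x) - aS N' (-x)) / (aS N (-x) * aS N' (-x))) := by
    rw [hg, hg']; field_simp
  rw [e, norm_mul, norm_div, norm_mul]
  have hden : (|x| / 6) * (|x| / 6) ≤ ‖aS N (-x)‖ * ‖aS N' (-x)‖ := mul_le_mul hax hax' hx6.le (norm_nonneg _)
  have hden0 : 0 < ‖aS N (-x)‖ * ‖aS N' (-x)‖ := lt_of_lt_of_le (by positivity) hden
  calc ‖cexp (-(I * (x : ℂ))) - 1‖ * (‖aS N (-x) - aS N' (-x)‖ / (‖aS N (-x)‖ * ‖aS N' (-x)‖))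
      ≤ 2 * ((x ^ 2 / N) / ((|x| / 6) * (|x| / 6))) := by
        apply mul_le_mul h2 _ (by positivity) (by norm_num)
        exact div_le_div₀ (by positivity) hrate (by positivity) hden
    _ = 72 / N := by
        have hx2 : x ^ 2 = |x| * |x| := by rw [← sq_abs]; ring
        rw [hx2]; field_simp; norm_num

/-! ## §3 Products over the coordinates: `χ_N(P) = Π_i γ_N(P_i)` -/

/-- [folklore] ABSTRACT PRODUCT TELESCOPING: if `‖a i‖, ‖a′ i‖ ≤ w i` and `‖a′ i − a i‖ ≤ δ i` (all `w, δ ≥ 0`) then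
`‖Π_{i∈s} a′ i − Π_{i∈s} a i‖ ≤ Σ_{i∈s} δ i · Π_{j∈s, j≠i} w j`. -/
theorem norm_prod_sub_prod_le {ι : Type*} [DecidableEq ι] (s : Finset ι) {a a' : ι → ℂ} {w δ : ι → ℝ}
    (hw : ∀ i, 0 ≤ w i) (ha : ∀ i, ‖a i‖ ≤ w i) (ha' : ∀ i, ‖a' i‖ ≤ w i) (hδ : ∀ i, ‖a' i - a i‖ ≤ δ i) :
    ‖∏ i ∈ s, a' i - ∏ i ∈ s, a i‖ ≤ ∑ i ∈ s, δ i * ∏ j ∈ s.erase i, w j := by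
  induction s using Finset.induction_on with
  | empty => simp
  | @insert i s hi ih =>
    rw [Finset.prod_insert hi, Finset.prod_insert hi, Finset.sum_insert hi, Finset.erase_insert hi]
    have hδ0 : ∀ i, 0 ≤ δ i := fun i => (norm_nonneg _).trans (hδ i)
    have hP' : ‖∏ j ∈ s, a' j‖ ≤ ∏ j ∈ s, w j := by
      rw [norm_prod]; exact Finset.prod_le_prod (fun j _ => norm_nonneg _) fun j _ => ha' j
    have hsplit : a' i * ∏ j ∈ s, a' j - a i * ∏ j ∈ s, a j
        = (a' i - a i) * ∏ j ∈ s, a' j + a i * (∏ j ∈ s, a' j - ∏ j ∈ s, a j) := by ring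
    rw [hsplit]
    have herase : ∀ k ∈ s, ∏ j ∈ (insert i s).erase k, w j = w i * ∏ j ∈ s.erase k, w j := by
      intro k hk
      have hik : i ≠ k := fun h => hi (h ▸ hk)
      rw [Finset.erase_insert_of_ne hik, Finset.prod_insert (fun h => hi (Finset.mem_of_mem_erase h))]
    calc ‖(a' i - a i) * ∏ j ∈ s, a' j + a i * (∏ j ∈ s, a' j - ∏ j ∈ s, a j)‖
        ≤ ‖(a' i - a i) * ∏ j ∈ s, a' j‖ + ‖a i * (∏ j ∈ s, a' j - ∏ j ∈ s, a j)‖ := norm_add_le _ _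
      _ = ‖a' i - a i‖ * ‖∏ j ∈ s, a' j‖ + ‖a i‖ * ‖∏ j ∈ s, a' j - ∏ j ∈ s, a j‖ := by rw [norm_mul, norm_mul]
      _ ≤ δ i * ∏ j ∈ s, w j + w i * ∑ k ∈ s, δ k * ∏ j ∈ s.erase k, w j :=
          add_le_add (mul_le_mul (hδ i) hP' (norm_nonneg _) (hδ0 i)) (mul_le_mul (ha i) ih (norm_nonneg _) (hw i))
      _ = δ i * ∏ j ∈ s, w j + ∑ k ∈ s, δ k * ∏ j ∈ (insert i s).erase k, w j := by
          rw [Finset.mul_sum]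
          congr 1
          exact Finset.sum_congr rfl fun k hk => by rw [herase k hk]; ring

variable {D : ℕ}

/-- [folklore] THE NORMALISED BLOCK-MEAN WEIGHT `χ_N(P) := Π_i γ_N(P_i)` (`= chiAl` at real momentum, part 3). -/
def chiS (N : ℕ) (P : Fin D → ℝ) : ℂ := ∏ i, gamS N (P i)

/-- THE PRODUCT WEIGHT `WS P := Π_i wS (P_i)`. -/
def WS (P : Fin D → ℝ) : ℝ := ∏ i, wS (P i)

/-- [folklore] `0 < WS P`. -/
theorem WS_pos (P : Fin D → ℝ) : 0 < WS P := Finset.prod_pos fun i _ => wS_pos (P i)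

/-- [folklore] `WS P ≤ 1`. -/
theorem WS_le_one (P : Fin D → ℝ) : WS P ≤ 1 :=
  Finset.prod_le_one (fun i _ => (wS_pos (P i)).le) fun i _ => wS_le_one (P i)

/-- [folklore] `Π_{j ≠ i} wS (P_j) = WS P · max 12 |P_i| / 12`. -/
theorem prod_erase_wS_eq (P : Fin D → ℝ) (i : Fin D) :
    ∏ j ∈ (Finset.univ : Finset (Fin D)).erase i, wS (P j) = WS P * max 12 |P i| / 12 := by
  have h := Finset.mul_prod_erase (Finset.univ : Finset (Fin D)) (fun j => wS (P j)) (Finset.mem_univ i)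
  have h12 : wS (P i) = 12 / max 12 |P i| := rfl
  have hm : (0 : ℝ) < max 12 |P i| := by positivity
  unfold WS
  rw [← h, h12]
  field_simp

/-- [folklore] **`‖χ_N(P)‖ ≤ WS P`** on the zone `|P_i| ≤ 5πN/3`. -/
theorem norm_chiS_le_WS {N : ℕ} (hN : 0 < N) {P : Fin D → ℝ} (hP : ∀ i, |P i| ≤ 5 * π / 3 * (N : ℝ)) : ‖chiS N P‖ ≤ WS P := by
  unfold chiS WS
  rw [norm_prod]
  exact Finset.prod_le_prod (fun i _ => norm_nonneg _) fun i _ => norm_gamS_le_wS hN (hP i)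

/-- [folklore] `‖χ_N(P)‖ ≤ 1`. -/
theorem norm_chiS_le_one (N : ℕ) (P : Fin D → ℝ) : ‖chiS N P‖ ≤ 1 := by
  unfold chiS
  rw [norm_prod]
  exact Finset.prod_le_one (fun i _ => norm_nonneg _) fun i _ => norm_gamS_le_one N (P i)

/-- [folklore] **TWO-LEVEL RATE of `χ_N`**: `‖χ_{N′}(P) − χ_N(P)‖ ≤ (6/N)·(Σ_i max 12 |P_i|)·WS P` for `1 ≤ N ≤ N′` on the level-`N` zone
(one coordinate at a time: the rate `72/N` of `γ` against the weights `wS` of the others; `Π_{j≠i} wS_j = WS·max(12,|P_i|)/12`). -/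
theorem norm_chiS_sub_chiS_le {N N' : ℕ} (hN : 0 < N) (hNN' : N ≤ N') {P : Fin D → ℝ} (hP : ∀ i, |P i| ≤ 5 * π / 3 * (N : ℝ)) :
    ‖chiS N' P - chiS N P‖ ≤ 6 / N * (∑ i, max 12 |P i|) * WS P := by
  have hN' : 0 < N' := lt_of_lt_of_le hN hNN'
  have hP' : ∀ i, |P i| ≤ 5 * π / 3 * (N' : ℝ) := fun i => (hP i).trans (by gcongr)
  have h := norm_prod_sub_prod_le (Finset.univ : Finset (Fin D)) (a := fun i => gamS N (P i)) (a' := fun i => gamS N' (P i))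
    (w := fun i => wS (P i)) (δ := fun _ => 72 / (N : ℝ)) (fun i => (wS_pos _).le) (fun i => norm_gamS_le_wS hN (hP i))
    (fun i => norm_gamS_le_wS hN' (hP' i)) (fun i => norm_gamS_sub_gamS_le hN hNN' (hP i))
  unfold chiS
  refine h.trans (le_of_eq ?_)
  simp_rw [prod_erase_wS_eq]
  rw [Finset.mul_sum, Finset.sum_mul]
  exact Finset.sum_congr rfl fun i _ => by ring

/-! ## §4 The level-free telescoped factor `E_l = e^{−iq_l} − 1` -/

/-- [folklore] THE TELESCOPED FACTOR `E_l(q) := e^{−iq_l} − 1` (`= dbAl_l·sbAl_l`, level- and label-free: `e^{−2πi·srep} = 1`). -/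
def ES (q : Fin D → ℝ) (l : Fin D) : ℂ := cexp (-(I * (q l : ℂ))) - 1

/-- [folklore] `‖E_l‖ ≤ |q_l|` — the smallness that cancels the `m = 0` pole of the pure-gauge feed. -/
theorem norm_ES_le (q : Fin D → ℝ) (l : Fin D) : ‖ES q l‖ ≤ |q l| := by
  unfold ES
  have h := Real.norm_exp_I_mul_ofReal_sub_one_le (x := -q l)
  rw [Real.norm_eq_abs, abs_neg] at h
  have e : -(I * (q l : ℂ)) = I * ((-q l : ℝ) : ℂ) := by push_cast; ring
  rw [e]
  exact h

/-- [folklore] `‖E_l‖ ≤ 2`. -/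
theorem norm_ES_le_two (q : Fin D → ℝ) (l : Fin D) : ‖ES q l‖ ≤ 2 := by
  unfold ES
  calc ‖cexp (-(I * (q l : ℂ))) - 1‖ ≤ ‖cexp (-(I * (q l : ℂ)))‖ + ‖(1 : ℂ)‖ := norm_sub_le _ _
    _ = 2 := by
        rw [show -(I * (q l : ℂ)) = I * ((-q l : ℝ) : ℂ) by push_cast; ring, Complex.norm_exp_I_mul_ofReal, norm_one]; norm_num

end Summit.QuantumFields.BalabanUV.Beta.GAN24.FineReadoutCauchyScalars

end
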